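import Summits.QuantumFields.BalabanUV.Beta.GAN24.CombChargeEvenClassPatterns

/-!
# `BalabanUV.Beta.GAN24.CombChargeAntisymPairForm` — binder row G-an2-4 ∕ (CONV-C), W-slot (α-0), ROW (C) AT LEVELS `≥ 1`, road-P2's JUNCTION BOOKKEEPING:
# **UNDER THE ANTISYMMETRIC-PAIR FORM OF THE LEG-AND-BOND SYMMETRISED CHARGE, THE THREE LETTERS `hW0 ∕ hFL ∕ hHC` OF MY F8 §2 ARE IDENTITIES — THE EVEN-CLASS ROW
# `hZeven` IS THE CROSSED-ORBIT CONSERVATION `hX` ALONE** (G-an2-4 CRUX TEAM (2), road-P2 chair `b2b-balaban-gan24-p2`, gen 49; journal [GAN24P2-G49-INTENT1])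

NOT IN PRINT; OUR BOOKKEEPING ([folklore] finite index algebra; 0 `def`, 0 cited fact, 0 `def … : Prop`, 0 sorry).  HONEST FRAMING (cell contract, verbatim): «discharging
`BetaPertH` makes Bałaban's UV stability UNCONDITIONAL — a real constructive-QFT result; it is NOT the continuum limit and NOT the Clay problem.»  HONEST DEPENDENCY (verbatim):
«continuum YM on T⁴ ⇐ BetaPertH ∧ nine spine estimates (0/9 proved); BetaPertH ⇐ (D1) ∧ (D4) ∧ CAP+tail; G-an2-4 gates asym, D1 and NE2/3/4.»

WHY.  My g48 junction files display the (C)-row of road FP's D1 literal on the 40 EVEN-CLASS patterns as FOUR zmode-level letters (`CombChargeEvenClassPatterns` §4 ∕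
`WrecAtEvenHalfRowsOfQLEvenFamilies` §2): `hW0` (all-equal charges zero), `hFL` (the `c_a²c_b²` flatness coefficient zero), `hHC` (transposition covariance of the diagonal
charges `(a,a;b,b) ↔ (b,b;a,a)` — NO HOLDER: transport along an axis permutation does not carry the comb to itself, `Beta.CombPermutationWitness`) and `hX` (conservation of
the crossed orbit sums).  The suppliers' located SHAPE of a word's charge is sharper than four letters: leaf-06 g53's exchange word is `word(μν;αβ) = P(μα;νβ) + P(να;μβ)`
with `P` ANTISYMMETRIC IN EACH PAIR (`ExchangeESectorValue.exchangeWord_sector_value` — `⟨q_{μα}, E2_{j+1} q_{νβ}⟩` — with `StaircaseCurrentAntisymm`; memo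
`HOME/b2b-balaban-gan24-formalise-leaf-06/g53/C-LEVELS-GE1-g53.md` §24), i.e. the quartic zero-mode form `Σ Z(κκ′;κ₁κ₂) c_κ c_κ′ w_κ₁ w_κ₂` is a QUADRATIC FORM IN `c ∧ w`.
This file records, as pure algebra, that under that form — asked only of the LEG-AND-BOND SYMMETRISED charge `LS`, with ANY pair function `R` antisymmetric in each of its two
index pairs (no symmetry `R(p;q) = R(q;p)`, no hypercubic covariance, no value) — the three letters `hW0`, `hFL`, `hHC` HOLD IDENTICALLY, and the `|c∧w|²` proportions
`LS(a,a;b,b) : LS-orbit(a,b;a,b) = 2 : −1` (leaf-02 g66's located «−2 : 1 : 1 : 0», `CT-VALUES-PLAN-v0.md` §6) are identities too; hence the even-class row is `hX` ALONE.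
* §1 **`flat_cov_of_pairFormLS`** (generic index type): `LS_A = LS-form of R`, `R` antisymmetric in each pair ⟹ `A a a a a = 0` (given that `A`'s all-equal `LS` is `4·A a a a a`),
  `A a a b b = A b b a a`, and the flatness coefficient `A a a b b + A b b a a + orbit(a,b;a,b) = 0` — EXACTLY the three per-level hypotheses `hWA ∕ hHA ∕ hFA` of
  `CombChargeEvenClassPatterns.families_of_flat_cov`; **`pairFormLS_of_pairForm`**: the entrywise form `A(κκ′;κ₁κ₂) = P(κκ₁;κ′κ₂) + P(κ′κ₁;κκ₂)` gives the `LS` form with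
  `R = 2P`; **`pairFormLS_add`**: the form is additive over words; **`exists_antisym_extension`**: a pair function antisymmetric OFF the diagonals (the suppliers' shape) has an
  everywhere-antisymmetric zero-extension; **`exists_pairForm_of_word`**: a word equal to such a `P` off the diagonals and `0` on them has bond
  symmetrisation = an entrywise pair form (the suppliers' one-`obtain` adapter); **`crossed_entries_of_pairForm`**: entrywise, the four crossed entries are equal and `A a a b b = −2·A a b a b`.
* §2 **`families_of_pairFormLS`**: at two levels `A` (form `R`) and `B` (form `S`), conservation of the crossed orbit sums `hX` gives the three families of
  `CombChargeEvenClassPatterns.evenClass_induction` ∕ `zsymLegSymEven_of_families`.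
* §3 **`zsymLegSymEven_of_pairFormLS_crossed`** (the literal's display, generic colour constants ∕ tables ∕ root as in `CombChargeEvenClassPatterns` §4): `hZeven` of
  `WrecAtEvenHalfRowsOfQLCEvenClasses.exists_allScalesSeq_JsRowD1Pin_of_QL_zsymLegSymEvenClasses` VERBATIM ⟸ **`hPair`** (at every level `m + 1`: SOME `R_m`, antisymmetric in
  each pair, with `LS_{m+1} = LS-form of R_m`) ∧ **`hX`**.  So the (TL) programme's deliverable to road-P2 can be: the antisymmetric-pair form per word (EX: typed by leaf-06 g53;
  CT: leaf-02's sectors) + ONE crossed value per pair and level; `hHC` needs no holder under it.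
Discharges NOTHING of (C) on the even class (the form and `hX` are hypotheses), nor (Q-L) ∕ (H1♮) ∕ (hW, hWall); asserts NO value and NO shape of Bałaban's tables; NEVER
«G-an2-4 closed» as (CONV-C); NOT D1, NOT `BetaPertH`, NOT continuum, NOT Clay.  2026-08-23; no existing file touched.
-/

noncomputable section

open Finset
open scoped BigOperators
open Literature.MathematicalPhysics.QuantumFieldTheory
open Literature.MathematicalPhysics.QuantumFieldTheory.Balaban1983to89
open Literature.MathematicalPhysics.QuantumFieldTheory.Balaban1983to89.Beta
open ExpKernelCalculus (MKer)
open OneStepResolventKernel (Fib)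
open AffineAveraging (Site box toSite)
open AveragingMixedJetTables (mixFFAt)
open PolarizationSign (reflSign)
open Summit.QuantumFields.BalabanUV.Beta.SecondOrderUnits (unitS₂)
open Summit.QuantumFields.BalabanUV.Beta.SpineRooted (T2RecAt)
open Summit.QuantumFields.BalabanUV.Beta.GAN24.CombesThomas (sfStep smStep)
open Summit.QuantumFields.BalabanUV.Beta.GAN24.BiStencilZeroMode (Tab zmode)
open Summit.QuantumFields.BalabanUV.Beta.GAN24.CombChargeEvenClassPatterns (evenClass_induction families_of_flat_cov zsymLegSymEven_of_flat_cov_crossed)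

namespace Summit.QuantumFields.BalabanUV.Beta.GAN24.CombChargeAntisymPairForm

/-! ## §1 The antisymmetric-pair form of the symmetrised charge and its three identities -/

section Algebra

variable {ι : Type*} {A B P R S : ι → ι → ι → ι → ℝ}

/-- [folklore] A pair function antisymmetric in its FIRST index pair vanishes on that pair's diagonal. -/
theorem pair_diag_fst (hR1 : ∀ a b c e, R b a c e = -R a b c e) (a c e : ι) : R a a c e = 0 := by
  have h := hR1 a a c e
  linarith

/-- [folklore] A pair function antisymmetric in its SECOND index pair vanishes on that pair's diagonal. -/
theorem pair_diag_snd (hR2 : ∀ a b c e, R a b e c = -R a b c e) (a b c : ι) : R a b c c = 0 := by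
  have h := hR2 a b c c
  linarith

/-- NOT IN PRINT; OUR BOOKKEEPING.  **THE THREE LETTERS ARE IDENTITIES UNDER THE ANTISYMMETRIC-PAIR FORM.**  Let the leg-and-bond symmetrised charge
`LS_A(κ,κ′;κ₁,κ₂) := A κκ′κ₁κ₂ + A κ′κκ₁κ₂ + (A κκ′κ₂κ₁ + A κ′κκ₂κ₁)` be the symmetrisation of a pair form, `LS_A(κ,κ′;κ₁,κ₂) = R(κκ₁;κ′κ₂) + R(κ′κ₁;κκ₂) + (R(κκ₂;κ′κ₁) +
R(κ′κ₂;κκ₁))` (`hE`), with `R` antisymmetric in its first pair (`hR1`) and in its second pair (`hR2`) — the zero-mode form is a quadratic form in `c ∧ w`.  Then: the all-equal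
entries vanish (`hW0`), the diagonal two-pair entries are transposition covariant (`hHC`), and the `c_a²c_b²` flatness coefficient vanishes (`hFL`) — the per-level hypotheses
`hWA ∕ hHA ∕ hFA` of `CombChargeEvenClassPatterns.families_of_flat_cov`, with no `a ≠ b` needed. -/
theorem flat_cov_of_pairFormLS
    (hE : ∀ κ κ' κ₁ κ₂, A κ κ' κ₁ κ₂ + A κ' κ κ₁ κ₂ + (A κ κ' κ₂ κ₁ + A κ' κ κ₂ κ₁) = R κ κ₁ κ' κ₂ + R κ' κ₁ κ κ₂ + (R κ κ₂ κ' κ₁ + R κ' κ₂ κ κ₁))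
    (hR1 : ∀ a b c e, R b a c e = -R a b c e) (hR2 : ∀ a b c e, R a b e c = -R a b c e) :
    (∀ a, A a a a a = 0) ∧ (∀ a b, A a a b b = A b b a a) ∧
    (∀ a b, A a a b b + A b b a a + (A a b a b + A b a a b + (A a b b a + A b a b a)) = 0) := by
  refine ⟨fun a => ?_, fun a b => ?_, fun a b => ?_⟩
  · have h := hE a a a a
    have h0 : R a a a a = 0 := pair_diag_fst hR1 a a a
    linarith
  · have h1 := hE a a b b
    have h2 := hE b b a a
    have h3 : R b a b a = R a b a b := by rw [hR1, hR2, neg_neg]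
    linarith
  · have h1 := hE a a b b
    have h2 := hE b b a a
    have h3 := hE a b a b
    have h4 : R b a b a = R a b a b := by rw [hR1, hR2, neg_neg]
    have h5 : R a a b b = 0 := pair_diag_fst hR1 a b b
    have h6 : R b b a a = 0 := pair_diag_fst hR1 b a a
    have h7 : R b a a b = -R a b a b := hR1 a b a b
    have h8 : R a b b a = -R a b a b := hR2 a b a b
    linarith

/-- NOT IN PRINT; OUR BOOKKEEPING.  **THE `|c∧w|²` PROPORTION ON THE SYMMETRISED CHARGE**: under the antisymmetric-pair form, twice the diagonal two-pair `LS` entry is minus the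
crossed orbit sum — `2·A a a b b = −(A abab + A baab + A abba + A baba)` (leaf-02 g66's located «Y : X₁ : X₂ = −2 : 1 : 1» after the symmetrisations; a sign-free identity here). -/
theorem diag_eq_crossed_of_pairFormLS
    (hE : ∀ κ κ' κ₁ κ₂, A κ κ' κ₁ κ₂ + A κ' κ κ₁ κ₂ + (A κ κ' κ₂ κ₁ + A κ' κ κ₂ κ₁) = R κ κ₁ κ' κ₂ + R κ' κ₁ κ κ₂ + (R κ κ₂ κ' κ₁ + R κ' κ₂ κ κ₁))
    (hR1 : ∀ a b c e, R b a c e = -R a b c e) (hR2 : ∀ a b c e, R a b e c = -R a b c e) (a b : ι) :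
    A a a b b + A a a b b + (A a b a b + A b a a b + (A a b b a + A b a b a)) = 0 := by
  obtain ⟨_, hH, hF⟩ := flat_cov_of_pairFormLS hE hR1 hR2
  have h1 := hH a b
  have h2 := hF a b
  linarith

/-- NOT IN PRINT; OUR BOOKKEEPING.  **THE ENTRYWISE FORM GIVES THE SYMMETRISED FORM** with `R = 2P`: if every entry is `A(κκ′;κ₁κ₂) = P(κκ₁;κ′κ₂) + P(κ′κ₁;κκ₂)` then `LS_A` has the
antisymmetric-pair form with `R := 2P` (and `2P` inherits both antisymmetries — `pairFormLS_antisym_fst ∕ _snd`). -/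
theorem pairFormLS_of_pairForm (hA : ∀ κ κ' κ₁ κ₂, A κ κ' κ₁ κ₂ = P κ κ₁ κ' κ₂ + P κ' κ₁ κ κ₂) (κ κ' κ₁ κ₂ : ι) :
    A κ κ' κ₁ κ₂ + A κ' κ κ₁ κ₂ + (A κ κ' κ₂ κ₁ + A κ' κ κ₂ κ₁)
      = 2 * P κ κ₁ κ' κ₂ + 2 * P κ' κ₁ κ κ₂ + (2 * P κ κ₂ κ' κ₁ + 2 * P κ' κ₂ κ κ₁) := by
  rw [hA κ κ' κ₁ κ₂, hA κ' κ κ₁ κ₂, hA κ κ' κ₂ κ₁, hA κ' κ κ₂ κ₁]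
  ring

/-- [folklore] `2P` is antisymmetric in the first pair when `P` is. -/
theorem pairFormLS_antisym_fst (hP1 : ∀ a b c e, P b a c e = -P a b c e) (a b c e : ι) : 2 * P b a c e = -(2 * P a b c e) := by
  rw [hP1]; ring

/-- [folklore] `2P` is antisymmetric in the second pair when `P` is. -/
theorem pairFormLS_antisym_snd (hP2 : ∀ a b c e, P a b e c = -P a b c e) (a b c e : ι) : 2 * P a b e c = -(2 * P a b c e) := by
  rw [hP2]; ring

/-- NOT IN PRINT; OUR BOOKKEEPING.  **ENTRYWISE PROPORTIONS** under the entrywise form `A(κκ′;κ₁κ₂) = P(κκ₁;κ′κ₂) + P(κ′κ₁;κκ₂)`: the all-equal entry is `0`, the four crossed entries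
of a pair are EQUAL, the diagonal two-pair entry is transposition covariant and equals `−2×` a crossed entry (the `|c∧w|²` tensor `2δ_{κκ′}δ_{κ₁κ₂} − δ_{κκ₁}δ_{κ′κ₂} − δ_{κκ₂}δ_{κ′κ₁}`
up to one scalar per pair). -/
theorem crossed_entries_of_pairForm (hA : ∀ κ κ' κ₁ κ₂, A κ κ' κ₁ κ₂ = P κ κ₁ κ' κ₂ + P κ' κ₁ κ κ₂)
    (hP1 : ∀ a b c e, P b a c e = -P a b c e) (hP2 : ∀ a b c e, P a b e c = -P a b c e) (a b : ι) :
    A a a a a = 0 ∧ A a a b b = A b b a a ∧ A a b a b = A a b b a ∧ A a b a b = A b a a b ∧ A a b a b = A b a b a ∧ A a a b b = -2 * A a b a b := by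
  have d1 : ∀ x c e, P x x c e = 0 := fun x c e => pair_diag_fst hP1 x c e
  have e1 : P b a b a = P a b a b := by rw [hP1, hP2, neg_neg]
  have e2 : P b a a b = -P a b a b := hP1 a b a b
  have e3 : P a b b a = -P a b a b := hP2 a b a b
  have z1 : P a a b b = 0 := d1 a b b
  have z2 : P b b a a = 0 := d1 b a a
  have z3 : P a a a a = 0 := d1 a a a
  refine ⟨?_, ?_, ?_, ?_, ?_, ?_⟩
  · rw [hA]; linarith
  · rw [hA, hA]; linarith
  · rw [hA, hA]; linarith
  · rw [hA, hA]; linarith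
  · rw [hA, hA]; linarith
  · rw [hA, hA]; linarith

/-- NOT IN PRINT; OUR BOOKKEEPING.  **THE FORM IS ADDITIVE OVER WORDS**: if `LS_A` has the antisymmetric-pair form with `R` and `LS_B` with `S`, then `LS_{A+B}` has it with `R + S`
(suppliers deliver per word; the antisymmetries of `R + S` are `antisym_add_fst ∕ _snd`). -/
theorem pairFormLS_add
    (hA : ∀ κ κ' κ₁ κ₂, A κ κ' κ₁ κ₂ + A κ' κ κ₁ κ₂ + (A κ κ' κ₂ κ₁ + A κ' κ κ₂ κ₁) = R κ κ₁ κ' κ₂ + R κ' κ₁ κ κ₂ + (R κ κ₂ κ' κ₁ + R κ' κ₂ κ κ₁))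
    (hB : ∀ κ κ' κ₁ κ₂, B κ κ' κ₁ κ₂ + B κ' κ κ₁ κ₂ + (B κ κ' κ₂ κ₁ + B κ' κ κ₂ κ₁) = S κ κ₁ κ' κ₂ + S κ' κ₁ κ κ₂ + (S κ κ₂ κ' κ₁ + S κ' κ₂ κ κ₁))
    (κ κ' κ₁ κ₂ : ι) :
    (A κ κ' κ₁ κ₂ + B κ κ' κ₁ κ₂) + (A κ' κ κ₁ κ₂ + B κ' κ κ₁ κ₂) + ((A κ κ' κ₂ κ₁ + B κ κ' κ₂ κ₁) + (A κ' κ κ₂ κ₁ + B κ' κ κ₂ κ₁))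
      = (R κ κ₁ κ' κ₂ + S κ κ₁ κ' κ₂) + (R κ' κ₁ κ κ₂ + S κ' κ₁ κ κ₂) + ((R κ κ₂ κ' κ₁ + S κ κ₂ κ' κ₁) + (R κ' κ₂ κ κ₁ + S κ' κ₂ κ κ₁)) := by
  have h1 := hA κ κ' κ₁ κ₂
  have h2 := hB κ κ' κ₁ κ₂
  linarith

/-- [folklore] Antisymmetry in the first pair is additive. -/
theorem antisym_add_fst (hR1 : ∀ a b c e, R b a c e = -R a b c e) (hS1 : ∀ a b c e, S b a c e = -S a b c e) (a b c e : ι) :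
    R b a c e + S b a c e = -(R a b c e + S a b c e) := by
  rw [hR1, hS1]; ring

/-- [folklore] Antisymmetry in the second pair is additive. -/
theorem antisym_add_snd (hR2 : ∀ a b c e, R a b e c = -R a b c e) (hS2 : ∀ a b c e, S a b e c = -S a b c e) (a b c e : ι) :
    R a b e c + S a b e c = -(R a b c e + S a b c e) := by
  rw [hR2, hS2]; ring

/-- NOT IN PRINT; OUR BOOKKEEPING.  **ZERO-EXTENSION OF AN OFF-DIAGONAL PAIR FUNCTION** (the suppliers' shape ⟶ this file's): a pair function `P` known to be antisymmetric in
each pair only OFF the diagonals (leaf-06 g53's `ExchangeESectorPattern.pairing_antisymm_left ∕ _right` carry `μ ≠ α` ∕ `ν ≠ β`; the word itself vanishes on the diagonals)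
has an everywhere-antisymmetric modification `R` agreeing with `P` off the diagonals (`R := P` off the diagonals, `0` on them) — so a word `[μ≠α][ν≠β]·P(μα;νβ) + [ν≠α][μ≠β]·P(να;μβ)`
is the entrywise pair form `R(μα;νβ) + R(να;μβ)` of `pairFormLS_of_pairForm`. -/
theorem exists_antisym_extension [DecidableEq ι] (P : ι → ι → ι → ι → ℝ)
    (h1 : ∀ a b c e, a ≠ b → c ≠ e → P b a c e = -P a b c e) (h2 : ∀ a b c e, a ≠ b → c ≠ e → P a b e c = -P a b c e) :
    ∃ R : ι → ι → ι → ι → ℝ, (∀ a b c e, R b a c e = -R a b c e) ∧ (∀ a b c e, R a b e c = -R a b c e) ∧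
      (∀ a b c e, a ≠ b → c ≠ e → R a b c e = P a b c e) ∧ (∀ a c e, R a a c e = 0) ∧ (∀ a b c, R a b c c = 0) := by
  refine ⟨fun a b c e => if a = b ∨ c = e then 0 else P a b c e, fun a b c e => ?_, fun a b c e => ?_, fun a b c e hab hce => ?_,
    fun a c e => ?_, fun a b c => ?_⟩
  · by_cases hab : a = b
    · subst hab; simp
    · by_cases hce : c = e
      · simp [hce]
      · have hba : ¬ b = a := fun h => hab h.symm
        simp only [hab, hba, hce, or_self, if_false]
        exact h1 a b c e hab hce
  · by_cases hab : a = b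
    · simp [hab]
    · by_cases hce : c = e
      · subst hce; simp
      · have hec : ¬ e = c := fun h => hce h.symm
        simp only [hab, hce, hec, or_self, if_false]
        exact h2 a b c e hab hce
  · simp [hab, hce]
  · simp
  · simp

/-- NOT IN PRINT; OUR BOOKKEEPING.  **A WORD GIVEN BY AN OFF-DIAGONAL PAIR FUNCTION IS AN ENTRYWISE PAIR FORM** (the suppliers' one-`obtain` adapter): if a word `W(μ,ν;α,β)`
(bonds `μ ν`, legs `α β`) equals `P(μα;νβ)` off the diagonals (`μ ≠ α`, `ν ≠ β`) and vanishes on them, with `P` antisymmetric in each pair off the diagonals (leaf-06 g53's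
`ExchangeESectorPattern` shape: `exchangeWord_sector_value` + `pairing_antisymm_left ∕ _right`), then its bond symmetrisation `W(μ,ν;α,β) + W(ν,μ;α,β)` is the entrywise pair form
`R(μα;νβ) + R(να;μβ)` of `pairFormLS_of_pairForm` ∕ `crossed_entries_of_pairForm`, `R` the zero-extension of `exists_antisym_extension`. -/
theorem exists_pairForm_of_word [DecidableEq ι] {W : ι → ι → ι → ι → ℝ} (P : ι → ι → ι → ι → ℝ)
    (hoff : ∀ μ ν α β, μ ≠ α → ν ≠ β → W μ ν α β = P μ α ν β) (hdiag₁ : ∀ μ ν β, W μ ν μ β = 0) (hdiag₂ : ∀ μ ν α, W μ ν α ν = 0)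
    (h1 : ∀ a b c e, a ≠ b → c ≠ e → P b a c e = -P a b c e) (h2 : ∀ a b c e, a ≠ b → c ≠ e → P a b e c = -P a b c e) :
    ∃ R : ι → ι → ι → ι → ℝ, (∀ a b c e, R b a c e = -R a b c e) ∧ (∀ a b c e, R a b e c = -R a b c e) ∧
      ∀ κ κ' κ₁ κ₂, W κ κ' κ₁ κ₂ + W κ' κ κ₁ κ₂ = R κ κ₁ κ' κ₂ + R κ' κ₁ κ κ₂ := by
  obtain ⟨R, hR1, hR2, hRoff, hRd1, hRd2⟩ := exists_antisym_extension P h1 h2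
  have hWR : ∀ μ ν α β, W μ ν α β = R μ α ν β := by
    intro μ ν α β
    by_cases hμα : μ = α
    · subst hμα; rw [hdiag₁, hRd1]
    · by_cases hνβ : ν = β
      · subst hνβ; rw [hdiag₂, hRd2]
      · rw [hoff μ ν α β hμα hνβ, hRoff μ α ν β hμα hνβ]
  exact ⟨R, hR1, hR2, fun κ κ' κ₁ κ₂ => by rw [hWR, hWR]⟩

/-! ## §2 Two levels: the three families from the form and the crossed conservation -/

/-- NOT IN PRINT; OUR BOOKKEEPING.  **THE THREE FAMILIES FROM THE FORM AND `hX`**: with the antisymmetric-pair form of `LS` at both levels (`A` = level `l+2` with `R`, `B` = level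
`l+1` with `S`), conservation of the CROSSED orbit sums alone (`hX`) gives the all-equal, diagonal two-pair and crossed two-pair families of the conservation equation `LS_A = LS_B`
(`CombChargeEvenClassPatterns.families_of_flat_cov` fed by §1). -/
theorem families_of_pairFormLS
    (hEA : ∀ κ κ' κ₁ κ₂, A κ κ' κ₁ κ₂ + A κ' κ κ₁ κ₂ + (A κ κ' κ₂ κ₁ + A κ' κ κ₂ κ₁) = R κ κ₁ κ' κ₂ + R κ' κ₁ κ κ₂ + (R κ κ₂ κ' κ₁ + R κ' κ₂ κ κ₁))
    (hR1 : ∀ a b c e, R b a c e = -R a b c e) (hR2 : ∀ a b c e, R a b e c = -R a b c e)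
    (hEB : ∀ κ κ' κ₁ κ₂, B κ κ' κ₁ κ₂ + B κ' κ κ₁ κ₂ + (B κ κ' κ₂ κ₁ + B κ' κ κ₂ κ₁) = S κ κ₁ κ' κ₂ + S κ' κ₁ κ κ₂ + (S κ κ₂ κ' κ₁ + S κ' κ₂ κ κ₁))
    (hS1 : ∀ a b c e, S b a c e = -S a b c e) (hS2 : ∀ a b c e, S a b e c = -S a b c e)
    (hX : ∀ a b, a ≠ b → A a b a b + A b a a b + (A a b b a + A b a b a) = B a b a b + B b a a b + (B a b b a + B b a b a)) :
    (∀ a, A a a a a + A a a a a + (A a a a a + A a a a a) = B a a a a + B a a a a + (B a a a a + B a a a a)) ∧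
    (∀ a b, a ≠ b → A a a b b + A a a b b + (A a a b b + A a a b b) = B a a b b + B a a b b + (B a a b b + B a a b b)) ∧
    (∀ a b, a ≠ b → A a b a b + A b a a b + (A a b b a + A b a b a) = B a b a b + B b a a b + (B a b b a + B b a b a)) := by
  obtain ⟨hWA, hHA, hFA⟩ := flat_cov_of_pairFormLS hEA hR1 hR2
  obtain ⟨hWB, hHB, hFB⟩ := flat_cov_of_pairFormLS hEB hS1 hS2
  exact families_of_flat_cov hWA hWB (fun a b _ => hFA a b) (fun a b _ => hFB a b) hHA hHB hX

end Algebra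

/-! ## §3 At the capstone's display: `hZeven` from the form at every level `≥ 1` and the crossed values -/

section Literal

variable {Lc : ℕ} [NeZero Lc] {r : Fin (3 + 1) → ℕ}

/-- NOT IN PRINT; OUR BOOKKEEPING.  **`hZeven` FROM THE ANTISYMMETRIC-PAIR FORM ∧ THE CROSSED VALUES.**  With, at every level `m + 1` (all levels `≥ 1`), SOME pair function `R_m`
antisymmetric in each of its two index pairs such that the leg-and-bond symmetrised charge `LS_{m+1}(κ,κ′;κ₁,κ₂)` of `zmode Lc (unitS₂_{m+1} T̃_{m+1}) κ κ′ (inl κ₁) (inl κ₂)`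
equals `R_m(κκ₁;κ′κ₂) + R_m(κ′κ₁;κκ₂) + R_m(κκ₂;κ′κ₁) + R_m(κ′κ₂;κκ₁)` (`hPair` — the zero-mode quartic form is a quadratic form in `c ∧ w`; the located shape of leaf-06 g53's
exchange word, DISPLAYED here as a hypothesis on the whole symmetrised charge), the conservation of the CROSSED orbit sums (`hX`, one equation per ordered distinct pair and level)
IS the whole even-class row `hZeven` of `WrecAtEvenHalfRowsOfQLCEvenClasses.exists_allScalesSeq_JsRowD1Pin_of_QL_zsymLegSymEvenClasses` (VERBATIM shape, generic colour
constants, tables and root — `CombChargeEvenClassPatterns.zsymLegSymEven_of_flat_cov_crossed` with its three letters `hW0 hFL hHC` discharged by §1).  `hHC` needs no holder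
under `hPair`. -/
theorem zsymLegSymEven_of_pairFormLS_crossed (cE cVH cΛ cE₂ cB : ℝ) (Tc : Fin 4 → Fin 4 → Fin 4 → Fin 4 → ℝ)
    (vh₂S : Fin (3 + 1) → (Fin (3 + 1) → ℤ) → Fin (3 + 1) → (Fin (3 + 1) → ℤ) → MKer (3 + 1) (Fib 3))
    (hPair : ∀ m : ℕ, ∃ R : Fin (3 + 1) → Fin (3 + 1) → Fin (3 + 1) → Fin (3 + 1) → ℝ,
      (∀ a b c e, R b a c e = -R a b c e) ∧ (∀ a b c e, R a b e c = -R a b c e) ∧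
      ∀ κ κ' κ₁ κ₂ : Fin (3 + 1),
        zmode Lc (unitS₂ (sfStep Lc (m + 1)) (smStep 3 Lc (m + 1)) (T2RecAt 3 Lc (toSite r) cE cVH cΛ cE₂ cB Tc vh₂S (mixFFAt (toSite r) Lc) (m + 1))) κ κ' (Sum.inl κ₁) (Sum.inl κ₂)
          + zmode Lc (unitS₂ (sfStep Lc (m + 1)) (smStep 3 Lc (m + 1)) (T2RecAt 3 Lc (toSite r) cE cVH cΛ cE₂ cB Tc vh₂S (mixFFAt (toSite r) Lc) (m + 1))) κ' κ (Sum.inl κ₁) (Sum.inl κ₂)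
          + (zmode Lc (unitS₂ (sfStep Lc (m + 1)) (smStep 3 Lc (m + 1)) (T2RecAt 3 Lc (toSite r) cE cVH cΛ cE₂ cB Tc vh₂S (mixFFAt (toSite r) Lc) (m + 1))) κ κ' (Sum.inl κ₂) (Sum.inl κ₁)
          + zmode Lc (unitS₂ (sfStep Lc (m + 1)) (smStep 3 Lc (m + 1)) (T2RecAt 3 Lc (toSite r) cE cVH cΛ cE₂ cB Tc vh₂S (mixFFAt (toSite r) Lc) (m + 1))) κ' κ (Sum.inl κ₂) (Sum.inl κ₁))
        = R κ κ₁ κ' κ₂ + R κ' κ₁ κ κ₂ + (R κ κ₂ κ' κ₁ + R κ' κ₂ κ κ₁))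
    (hX : ∀ (l : ℕ) (a b : Fin (3 + 1)), a ≠ b →
      zmode Lc (unitS₂ (sfStep Lc (l + 1 + 1)) (smStep 3 Lc (l + 1 + 1)) (T2RecAt 3 Lc (toSite r) cE cVH cΛ cE₂ cB Tc vh₂S (mixFFAt (toSite r) Lc) (l + 1 + 1))) a b (Sum.inl a) (Sum.inl b) + zmode Lc (unitS₂ (sfStep Lc (l + 1 + 1)) (smStep 3 Lc (l + 1 + 1)) (T2RecAt 3 Lc (toSite r) cE cVH cΛ cE₂ cB Tc vh₂S (mixFFAt (toSite r) Lc) (l + 1 + 1))) b a (Sum.inl a) (Sum.inl b) + (zmode Lc (unitS₂ (sfStep Lc (l + 1 + 1)) (smStep 3 Lc (l + 1 + 1)) (T2RecAt 3 Lc (toSite r) cE cVH cΛ cE₂ cB Tc vh₂S (mixFFAt (toSite r) Lc) (l + 1 + 1))) a b (Sum.inl b) (Sum.inl a) + zmode Lc (unitS₂ (sfStep Lc (l + 1 + 1)) (smStep 3 Lc (l + 1 + 1)) (T2RecAt 3 Lc (toSite r) cE cVH cΛ cE₂ cB Tc vh₂S (mixFFAt (toSite r) Lc) (l + 1 + 1)))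 b a (Sum.inl b) (Sum.inl a))
      = zmode Lc (unitS₂ (sfStep Lc (l + 1)) (smStep 3 Lc (l + 1)) (T2RecAt 3 Lc (toSite r) cE cVH cΛ cE₂ cB Tc vh₂S (mixFFAt (toSite r) Lc) (l + 1))) a b (Sum.inl a) (Sum.inl b) + zmode Lc (unitS₂ (sfStep Lc (l + 1)) (smStep 3 Lc (l + 1)) (T2RecAt 3 Lc (toSite r) cE cVH cΛ cE₂ cB Tc vh₂S (mixFFAt (toSite r) Lc) (l + 1))) b a (Sum.inl a) (Sum.inl b) + (zmode Lc (unitS₂ (sfStep Lc (l + 1)) (smStep 3 Lc (l + 1)) (T2RecAt 3 Lc (toSite r) cE cVH cΛ cE₂ cB Tc vh₂S (mixFFAt (toSite r) Lc) (l + 1))) a b (Sum.inl b) (Sum.inl a) + zmode Lc (unitS₂ (sfStep Lc (l + 1)) (smStep 3 Lc (l + 1)) (T2RecAt 3 Lc (toSite r) cE cVH cΛ cE₂ cB Tc vh₂S (mixFFAt (toSite r) Lc) (l + 1))) b a (Sum.inl b) (Sum.inl a)))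
    (l : ℕ) (κ κ' κ₁ κ₂ : Fin (3 + 1)) (heven : ¬ ∃ α : Fin 4, reflSign α κ * reflSign α κ' * reflSign α κ₁ * reflSign α κ₂ = -1) :
    zmode Lc (unitS₂ (sfStep Lc (l + 1 + 1)) (smStep 3 Lc (l + 1 + 1)) (T2RecAt 3 Lc (toSite r) cE cVH cΛ cE₂ cB Tc vh₂S (mixFFAt (toSite r) Lc) (l + 1 + 1))) κ κ' (Sum.inl κ₁) (Sum.inl κ₂)
        + zmode Lc (unitS₂ (sfStep Lc (l + 1 + 1)) (smStep 3 Lc (l + 1 + 1)) (T2RecAt 3 Lc (toSite r) cE cVH cΛ cE₂ cB Tc vh₂S (mixFFAt (toSite r) Lc) (l + 1 + 1))) κ' κ (Sum.inl κ₁) (Sum.inl κ₂)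
        + (zmode Lc (unitS₂ (sfStep Lc (l + 1 + 1)) (smStep 3 Lc (l + 1 + 1)) (T2RecAt 3 Lc (toSite r) cE cVH cΛ cE₂ cB Tc vh₂S (mixFFAt (toSite r) Lc) (l + 1 + 1))) κ κ' (Sum.inl κ₂) (Sum.inl κ₁)
        + zmode Lc (unitS₂ (sfStep Lc (l + 1 + 1)) (smStep 3 Lc (l + 1 + 1)) (T2RecAt 3 Lc (toSite r) cE cVH cΛ cE₂ cB Tc vh₂S (mixFFAt (toSite r) Lc) (l + 1 + 1))) κ' κ (Sum.inl κ₂) (Sum.inl κ₁))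
      = zmode Lc (unitS₂ (sfStep Lc (l + 1)) (smStep 3 Lc (l + 1)) (T2RecAt 3 Lc (toSite r) cE cVH cΛ cE₂ cB Tc vh₂S (mixFFAt (toSite r) Lc) (l + 1))) κ κ' (Sum.inl κ₁) (Sum.inl κ₂)
        + zmode Lc (unitS₂ (sfStep Lc (l + 1)) (smStep 3 Lc (l + 1)) (T2RecAt 3 Lc (toSite r) cE cVH cΛ cE₂ cB Tc vh₂S (mixFFAt (toSite r) Lc) (l + 1))) κ' κ (Sum.inl κ₁) (Sum.inl κ₂)
        + (zmode Lc (unitS₂ (sfStep Lc (l + 1)) (smStep 3 Lc (l + 1)) (T2RecAt 3 Lc (toSite r) cE cVH cΛ cE₂ cB Tc vh₂S (mixFFAt (toSite r) Lc) (l + 1))) κ κ' (Sum.inl κ₂) (Sum.inl κ₁)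
        + zmode Lc (unitS₂ (sfStep Lc (l + 1)) (smStep 3 Lc (l + 1)) (T2RecAt 3 Lc (toSite r) cE cVH cΛ cE₂ cB Tc vh₂S (mixFFAt (toSite r) Lc) (l + 1))) κ' κ (Sum.inl κ₂) (Sum.inl κ₁)) := by
  have hW0 : ∀ (m : ℕ) (a : Fin (3 + 1)),
      zmode Lc (unitS₂ (sfStep Lc (m + 1)) (smStep 3 Lc (m + 1)) (T2RecAt 3 Lc (toSite r) cE cVH cΛ cE₂ cB Tc vh₂S (mixFFAt (toSite r) Lc) (m + 1))) a a (Sum.inl a) (Sum.inl a) = 0 := by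
    intro m a
    obtain ⟨R, hR1, hR2, hE⟩ := hPair m
    exact (flat_cov_of_pairFormLS
      (A := fun κ κ' κ₁ κ₂ => zmode Lc (unitS₂ (sfStep Lc (m + 1)) (smStep 3 Lc (m + 1)) (T2RecAt 3 Lc (toSite r) cE cVH cΛ cE₂ cB Tc vh₂S (mixFFAt (toSite r) Lc) (m + 1))) κ κ' (Sum.inl κ₁) (Sum.inl κ₂))
      hE hR1 hR2).1 a
  have hHC : ∀ (m : ℕ) (a b : Fin (3 + 1)),
      zmode Lc (unitS₂ (sfStep Lc (m + 1)) (smStep 3 Lc (m + 1)) (T2RecAt 3 Lc (toSite r) cE cVH cΛ cE₂ cB Tc vh₂S (mixFFAt (toSite r) Lc) (m + 1))) a a (Sum.inl b) (Sum.inl b)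
        = zmode Lc (unitS₂ (sfStep Lc (m + 1)) (smStep 3 Lc (m + 1)) (T2RecAt 3 Lc (toSite r) cE cVH cΛ cE₂ cB Tc vh₂S (mixFFAt (toSite r) Lc) (m + 1))) b b (Sum.inl a) (Sum.inl a) := by
    intro m a b
    obtain ⟨R, hR1, hR2, hE⟩ := hPair m
    exact (flat_cov_of_pairFormLS
      (A := fun κ κ' κ₁ κ₂ => zmode Lc (unitS₂ (sfStep Lc (m + 1)) (smStep 3 Lc (m + 1)) (T2RecAt 3 Lc (toSite r) cE cVH cΛ cE₂ cB Tc vh₂S (mixFFAt (toSite r) Lc) (m + 1))) κ κ' (Sum.inl κ₁) (Sum.inl κ₂))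
      hE hR1 hR2).2.1 a b
  have hFL : ∀ (m : ℕ) (a b : Fin (3 + 1)), a ≠ b →
      zmode Lc (unitS₂ (sfStep Lc (m + 1)) (smStep 3 Lc (m + 1)) (T2RecAt 3 Lc (toSite r) cE cVH cΛ cE₂ cB Tc vh₂S (mixFFAt (toSite r) Lc) (m + 1))) a a (Sum.inl b) (Sum.inl b) + zmode Lc (unitS₂ (sfStep Lc (m + 1)) (smStep 3 Lc (m + 1)) (T2RecAt 3 Lc (toSite r) cE cVH cΛ cE₂ cB Tc vh₂S (mixFFAt (toSite r) Lc) (m + 1))) b b (Sum.inl a) (Sum.inl a)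
        + (zmode Lc (unitS₂ (sfStep Lc (m + 1)) (smStep 3 Lc (m + 1)) (T2RecAt 3 Lc (toSite r) cE cVH cΛ cE₂ cB Tc vh₂S (mixFFAt (toSite r) Lc) (m + 1))) a b (Sum.inl a) (Sum.inl b) + zmode Lc (unitS₂ (sfStep Lc (m + 1)) (smStep 3 Lc (m + 1)) (T2RecAt 3 Lc (toSite r) cE cVH cΛ cE₂ cB Tc vh₂S (mixFFAt (toSite r) Lc) (m + 1))) b a (Sum.inl a) (Sum.inl b) + (zmode Lc (unitS₂ (sfStep Lc (m + 1)) (smStep 3 Lc (m + 1)) (T2RecAt 3 Lc (toSite r) cE cVH cΛ cE₂ cB Tc vh₂S (mixFFAt (toSite r) Lc) (m + 1))) a b (Sum.inl b) (Sum.inl a) + zmode Lc (unitS₂ (sfStep Lc (m + 1)) (smStep 3 Lc (m + 1)) (T2RecAt 3 Lc (toSite r) cE cVH cΛ cE₂ cB Tc vh₂S (mixFFAt (toSite r) Lc) (m + 1))) b a (Sum.inl b) (Sum.inl a))) = 0 := by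
    intro m a b _
    obtain ⟨R, hR1, hR2, hE⟩ := hPair m
    exact (flat_cov_of_pairFormLS
      (A := fun κ κ' κ₁ κ₂ => zmode Lc (unitS₂ (sfStep Lc (m + 1)) (smStep 3 Lc (m + 1)) (T2RecAt 3 Lc (toSite r) cE cVH cΛ cE₂ cB Tc vh₂S (mixFFAt (toSite r) Lc) (m + 1))) κ κ' (Sum.inl κ₁) (Sum.inl κ₂))
      hE hR1 hR2).2.2 a b
  exact zsymLegSymEven_of_flat_cov_crossed cE cVH cΛ cE₂ cB Tc vh₂S hW0 hFL hHC hX l κ κ' κ₁ κ₂ heven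

end Literal

end Summit.QuantumFields.BalabanUV.Beta.GAN24.CombChargeAntisymPairForm

end
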